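import Mathlib
import Summits.FinalStateConjecture.FinalStateConjecture.Theorems.EternalPapapetrouSchwarzschildExteriorModeRigidityTimeConv
import HarnessLib

/-!
# Route EternalPapapetrou · SchwarzschildExteriorModeRigidity — the reduced operator on jets

Helper file for item stmt-FinalStateConjecture-10039 (`SchwarzschildExteriorModeRigidity`).

After projection onto a finite family of angular test functions, a solution of the wave equation
on the Schwarzschild exterior (ingoing Eddington–Finkelstein/Kerr–Schild time `t`, area radius
`r > 2M`) becomes a vector-valued function `V(t, r)` solving the reduced `1+1` system
`−(1+2M/r) V_tt + (4M/r) V_rt + (2M/r²) V_t + (1−2M/r) V_rr + (2/r)(1−M/r) V_r + r⁻² Λ V = 0`.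
We encode this through the *jet* `(V, V', V'')` (value, Fréchet derivative, second derivative on
the strip `S = ℝ × (2M, ∞)`): `IsRWJet` records the differentiability, the symmetry of `V''` and
the equation (`RWJet`, bundled), `RWJet.Bounds` the uniform-in-`t` bounds on compact `r`-ranges. The
main result of the file is that time convolution with an integrable kernel preserves both.
[folklore]
-/

set_option linter.dupNamespace false

noncomputable section

namespace Summit.FinalStateConjecture.FinalStateConjecture.Theorems

open MeasureTheory Set Filter Topology Metric

namespace EternalPapapetrou.ModeRigidity

variable {E : Type*} [NormedAddCommGroup E] [NormedSpace ℝ E] [CompleteSpace E]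

/-- The unit vector `∂ₜ` of the `(t, r)` plane. [folklore] -/
abbrev e₁ : ℝ × ℝ := (1, 0)
/-- The unit vector `∂ᵣ` of the `(t, r)` plane. [folklore] -/
abbrev e₂ : ℝ × ℝ := (0, 1)

/-- The strip `S = ℝ × (2M, ∞)`. [folklore] -/
abbrev strip (M : ℝ) : Set (ℝ × ℝ) := univ ×ˢ Ioi (2 * M)

omit [CompleteSpace E] in
/-- A continuous linear map on `ℝ × ℝ` is bounded by the sum of the norms of its values on the
two basis vectors. [folklore] -/
theorem norm_clm_le_of_basis {F : Type*} [NormedAddCommGroup F] [NormedSpace ℝ F]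
    (L : ℝ × ℝ →L[ℝ] F) : ‖L‖ ≤ ‖L e₁‖ + ‖L e₂‖ := by
  refine ContinuousLinearMap.opNorm_le_bound _ (by positivity) fun v ↦ ?_
  have hv : v = v.1 • e₁ + v.2 • e₂ := by ext <;> simp
  have h1 : |v.1| ≤ ‖v‖ := by rw [← Real.norm_eq_abs]; exact norm_fst_le v
  have h2 : |v.2| ≤ ‖v‖ := by rw [← Real.norm_eq_abs]; exact norm_snd_le v
  calc ‖L v‖ = ‖v.1 • L e₁ + v.2 • L e₂‖ := by
        conv_lhs => rw [hv]
        rw [map_add, map_smul, map_smul]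
    _ ≤ |v.1| * ‖L e₁‖ + |v.2| * ‖L e₂‖ := by
        refine (norm_add_le _ _).trans ?_
        rw [norm_smul, norm_smul, Real.norm_eq_abs, Real.norm_eq_abs]
    _ ≤ ‖v‖ * ‖L e₁‖ + ‖v‖ * ‖L e₂‖ := by gcongr
    _ = (‖L e₁‖ + ‖L e₂‖) * ‖v‖ := by ring

/-- The linear map `(x, y) ↦ x • a + y • b` on `ℝ × ℝ` (a Fréchet derivative with partials
`a = ∂ₜ`, `b = ∂ᵣ`). [folklore] -/
def L₁ (a b : E) : ℝ × ℝ →L[ℝ] E :=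
  (ContinuousLinearMap.fst ℝ ℝ ℝ).smulRight a + (ContinuousLinearMap.snd ℝ ℝ ℝ).smulRight b

omit [CompleteSpace E] in
/-- Values of `L₁`. [folklore] -/
@[simp] theorem L₁_apply (a b : E) (v : ℝ × ℝ) : L₁ a b v = v.1 • a + v.2 • b := by
  simp [L₁]

omit [CompleteSpace E] in
/-- `L₁` is continuous in its two arguments. [folklore] -/
theorem continuous_L₁ : Continuous fun ab : E × E ↦ L₁ ab.1 ab.2 := by
  have h : ∀ ab : E × E, L₁ ab.1 ab.2 =
      ContinuousLinearMap.smulRightL ℝ (ℝ × ℝ) E (ContinuousLinearMap.fst ℝ ℝ ℝ) ab.1 +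
        ContinuousLinearMap.smulRightL ℝ (ℝ × ℝ) E (ContinuousLinearMap.snd ℝ ℝ ℝ) ab.2 := by
    intro ab
    exact ContinuousLinearMap.ext fun v ↦ by simp [L₁]
  simp_rw [h]
  fun_prop

omit [CompleteSpace E] in
/-- Norm bound for `L₁`. [folklore] -/
theorem norm_L₁_le (a b : E) : ‖L₁ a b‖ ≤ ‖a‖ + ‖b‖ := by
  refine (norm_clm_le_of_basis _).trans ?_
  simp

/-- The reduced (Regge–Wheeler type) operator of the Schwarzschild exterior in ingoing
Eddington–Finkelstein time, on jets at area radius `r`: value `v`, partials `vt, vr`, second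
partials `vtt, vtr, vrr`, angular operator `Λ`. [folklore] -/
def rwOp (M : ℝ) (Λ : E →L[ℝ] E) (r : ℝ) (v vt vr vtt vtr vrr : E) : E :=
  (-(1 + 2 * M / r)) • vtt + (4 * M / r) • vtr + (2 * M / r ^ 2) • vt
    + (1 - 2 * M / r) • vrr + (2 / r * (1 - M / r)) • vr + (r ^ 2)⁻¹ • Λ v

/-- **Jets of solutions of the reduced system** (data + properties, bundled): the value `V`,
its partial derivatives `Vt, Vr` and second partials `Vtt, Vtr, Vrr` on the strip
(`∂ₜ Vr = Vtr = ∂ᵣ Vt`: symmetry is built in), the second partials continuous, solving the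
reduced equation. [folklore] -/
structure RWJet (M : ℝ) (Λ : E →L[ℝ] E) where
  /-- the function -/
  V : ℝ × ℝ → E
  /-- `∂ₜ V` -/
  Vt : ℝ × ℝ → E
  /-- `∂ᵣ V` -/
  Vr : ℝ × ℝ → E
  /-- `∂ₜ∂ₜ V` -/
  Vtt : ℝ × ℝ → E
  /-- `∂ₜ∂ᵣ V = ∂ᵣ∂ₜ V` -/
  Vtr : ℝ × ℝ → E
  /-- `∂ᵣ∂ᵣ V` -/
  Vrr : ℝ × ℝ → E
  hasFDerivAt : ∀ p ∈ strip M, HasFDerivAt V (L₁ (Vt p) (Vr p)) p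
  hasFDerivAt_t : ∀ p ∈ strip M, HasFDerivAt Vt (L₁ (Vtt p) (Vtr p)) p
  hasFDerivAt_r : ∀ p ∈ strip M, HasFDerivAt Vr (L₁ (Vtr p) (Vrr p)) p
  cont_tt : ContinuousOn Vtt (strip M)
  cont_tr : ContinuousOn Vtr (strip M)
  cont_rr : ContinuousOn Vrr (strip M)
  pde : ∀ p ∈ strip M, rwOp M Λ p.2 (V p) (Vt p) (Vr p) (Vtt p) (Vtr p) (Vrr p) = 0

namespace RWJet

variable {M : ℝ} {Λ : E →L[ℝ] E}

/-- Uniform-in-`t` bounds of a jet on every compact range of `r` (the bound as data).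
[folklore] -/
structure Bounds (J : RWJet M Λ) where
  /-- the bound on `ℝ × [a, b]` -/
  C : ℝ → ℝ → ℝ
  le : ∀ a b : ℝ, 2 * M < a → a ≤ b → ∀ p : ℝ × ℝ, p.2 ∈ Icc a b →
    ‖J.V p‖ ≤ C a b ∧ ‖J.Vt p‖ ≤ C a b ∧ ‖J.Vr p‖ ≤ C a b ∧
      ‖J.Vtt p‖ ≤ C a b ∧ ‖J.Vtr p‖ ≤ C a b ∧ ‖J.Vrr p‖ ≤ C a b

omit [CompleteSpace E] in
/-- `V` is continuous on the strip. [folklore] -/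
theorem continuousOn (J : RWJet M Λ) : ContinuousOn J.V (strip M) :=
  fun p hp ↦ (J.hasFDerivAt p hp).continuousAt.continuousWithinAt

omit [CompleteSpace E] in
/-- `Vt` is continuous on the strip. [folklore] -/
theorem continuousOn_t (J : RWJet M Λ) : ContinuousOn J.Vt (strip M) :=
  fun p hp ↦ (J.hasFDerivAt_t p hp).continuousAt.continuousWithinAt

omit [CompleteSpace E] in
/-- `Vr` is continuous on the strip. [folklore] -/
theorem continuousOn_r (J : RWJet M Λ) : ContinuousOn J.Vr (strip M) :=
  fun p hp ↦ (J.hasFDerivAt_r p hp).continuousAt.continuousWithinAt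

end RWJet

/-! ### Continuity of `timeConv` on the strip -/

/-- The strip is open. [folklore] -/
theorem isOpen_strip (M : ℝ) : IsOpen (strip M : Set (ℝ × ℝ)) := isOpen_univ.prod isOpen_Ioi

/-- In the product metric, closeness controls the `r`-coordinate. [folklore] -/
theorem abs_snd_sub_lt_of_dist_lt {p₀ q : ℝ × ℝ} {ε : ℝ} (h : dist q p₀ < ε) :
    |q.2 - p₀.2| < ε := by
  have : dist q.2 p₀.2 ≤ dist q p₀ := by rw [Prod.dist_eq]; exact le_max_right _ _
  rw [Real.dist_eq] at this
  exact lt_of_le_of_lt this h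

omit [CompleteSpace E] in
/-- If `U` is continuous on the strip and locally (in `r`) uniformly (in `t`) bounded, then
`timeConv k U` is continuous on the strip for every integrable `k`. [folklore] -/
theorem continuousOn_timeConv {k : ℝ → ℝ} (hk : Integrable k) {U : ℝ × ℝ → E} {M : ℝ}
    (hU : ContinuousOn U (strip M))
    (hb : ∀ a b : ℝ, 2 * M < a → a ≤ b → ∃ C, ∀ p : ℝ × ℝ, p.2 ∈ Icc a b → ‖U p‖ ≤ C) :
    ContinuousOn (timeConv k U) (strip M) := by
  intro p₀ hp₀
  have hr₀ : 2 * M < p₀.2 := hp₀.2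
  set ε := (p₀.2 - 2 * M) / 2 with hε
  have hε0 : 0 < ε := by rw [hε]; linarith
  obtain ⟨C, hC⟩ := hb (p₀.2 - ε) (p₀.2 + ε) (by rw [hε]; linarith) (by linarith)
  have hball : ∀ q : ℝ × ℝ, dist q p₀ < ε → q.2 ∈ Icc (p₀.2 - ε) (p₀.2 + ε) ∧ 2 * M < q.2 := by
    intro q hq
    have h2 := abs_lt.1 (abs_snd_sub_lt_of_dist_lt hq)
    refine ⟨⟨by linarith, by linarith⟩, ?_⟩
    rw [hε] at h2
    linarith
  refine ContinuousAt.continuousWithinAt ?_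
  show ContinuousAt (fun x : ℝ × ℝ ↦ ∫ s, k s • U (x.1 - s, x.2)) p₀
  refine continuousAt_of_dominated (bound := fun s ↦ ‖k s‖ * C) ?_ ?_ (hk.norm.mul_const C) ?_
  · filter_upwards [ball_mem_nhds p₀ hε0] with q hq
    exact hk.aestronglyMeasurable.smul
      (continuous_slice hU q.1 (hball q hq).2).aestronglyMeasurable
  · filter_upwards [ball_mem_nhds p₀ hε0] with q hq
    refine Eventually.of_forall fun s ↦ ?_
    rw [norm_smul]
    exact mul_le_mul_of_nonneg_left (hC _ (hball q hq).1) (norm_nonneg _)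
  · refine Eventually.of_forall fun s ↦ ?_
    have hmem : ((p₀.1 - s, p₀.2) : ℝ × ℝ) ∈ strip M := ⟨mem_univ _, hr₀⟩
    have h1 : ContinuousAt U (p₀.1 - s, p₀.2) := hU.continuousAt ((isOpen_strip M).mem_nhds hmem)
    have h2 : ContinuousAt (fun x : ℝ × ℝ ↦ ((x.1 - s, x.2) : ℝ × ℝ)) p₀ := by fun_prop
    exact (h1.comp_of_eq h2 rfl).const_smul (k s)

/-! ### `timeConv` commutes with the reduced operator -/

omit [CompleteSpace E] in
/-- A continuous slice, bounded on the support of an integrable kernel, is integrable against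
it. [folklore] -/
theorem integrable_kernel_smul {k : ℝ → ℝ} (hk : Integrable k) {g : ℝ → E} (hg : Continuous g)
    {C : ℝ} (hb : ∀ s, k s ≠ 0 → ‖g s‖ ≤ C) : Integrable fun s ↦ k s • g s := by
  refine Integrable.mono' (hk.norm.mul_const C) (hk.aestronglyMeasurable.smul hg.aestronglyMeasurable)
    (Eventually.of_forall fun s ↦ ?_)
  by_cases hs : k s = 0
  · simp [hs]
  · rw [norm_smul]
    exact mul_le_mul_of_nonneg_left (hb s hs) (norm_nonneg _)

/-- **`timeConv` commutes with `rwOp`.** For slices that are continuous and bounded, the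
reduced operator of the convolved jet is the convolution of the reduced operator applied to the
jet (bounds are only needed on the support of the kernel). [folklore] -/
theorem rwOp_timeConv (M : ℝ) (Λ : E →L[ℝ] E) {k : ℝ → ℝ} (hk : Integrable k)
    {W₀ W₁ W₂ W₃ W₄ W₅ : ℝ × ℝ → E} {p : ℝ × ℝ} {C : ℝ}
    (h₀ : Continuous fun s ↦ W₀ (p.1 - s, p.2)) (h₁ : Continuous fun s ↦ W₁ (p.1 - s, p.2))
    (h₂ : Continuous fun s ↦ W₂ (p.1 - s, p.2)) (h₃ : Continuous fun s ↦ W₃ (p.1 - s, p.2))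
    (h₄ : Continuous fun s ↦ W₄ (p.1 - s, p.2)) (h₅ : Continuous fun s ↦ W₅ (p.1 - s, p.2))
    (b₀ : ∀ s, k s ≠ 0 → ‖W₀ (p.1 - s, p.2)‖ ≤ C) (b₁ : ∀ s, k s ≠ 0 → ‖W₁ (p.1 - s, p.2)‖ ≤ C)
    (b₂ : ∀ s, k s ≠ 0 → ‖W₂ (p.1 - s, p.2)‖ ≤ C) (b₃ : ∀ s, k s ≠ 0 → ‖W₃ (p.1 - s, p.2)‖ ≤ C)
    (b₄ : ∀ s, k s ≠ 0 → ‖W₄ (p.1 - s, p.2)‖ ≤ C) (b₅ : ∀ s, k s ≠ 0 → ‖W₅ (p.1 - s, p.2)‖ ≤ C) :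
    rwOp M Λ p.2 (timeConv k W₀ p) (timeConv k W₁ p) (timeConv k W₂ p) (timeConv k W₃ p)
        (timeConv k W₄ p) (timeConv k W₅ p) =
      timeConv k (fun q ↦ rwOp M Λ q.2 (W₀ q) (W₁ q) (W₂ q) (W₃ q) (W₄ q) (W₅ q)) p := by
  have i₀ : Integrable fun s ↦ k s • W₀ (p.1 - s, p.2) := integrable_kernel_smul hk h₀ b₀
  have cΛ : Continuous fun s ↦ Λ (W₀ (p.1 - s, p.2)) := Λ.continuous.comp h₀
  have bΛ : ∀ s, k s ≠ 0 → ‖Λ (W₀ (p.1 - s, p.2))‖ ≤ ‖Λ‖ * C := fun s hs ↦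
    Λ.le_opNorm_of_le (b₀ s hs)
  -- the six integrable terms, in the normal form `(c * k s) • X`
  have mk : ∀ {X : ℝ → E} (c : ℝ), Integrable (fun s ↦ k s • X s) →
      Integrable (fun s ↦ (c * k s) • X s) := fun {X} c h ↦
    (h.smul c).congr (Eventually.of_forall fun s ↦ by simp only [Pi.smul_apply, smul_smul])
  have g1 : Integrable fun s ↦ (-(1 + 2 * M / p.2) * k s) • W₃ (p.1 - s, p.2) :=
    mk _ (integrable_kernel_smul hk h₃ b₃)
  have g2 : Integrable fun s ↦ (4 * M / p.2 * k s) • W₄ (p.1 - s, p.2) :=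
    mk _ (integrable_kernel_smul hk h₄ b₄)
  have g3 : Integrable fun s ↦ (2 * M / p.2 ^ 2 * k s) • W₁ (p.1 - s, p.2) :=
    mk _ (integrable_kernel_smul hk h₁ b₁)
  have g4 : Integrable fun s ↦ ((1 - 2 * M / p.2) * k s) • W₅ (p.1 - s, p.2) :=
    mk _ (integrable_kernel_smul hk h₅ b₅)
  have g5 : Integrable fun s ↦ (2 / p.2 * (1 - M / p.2) * k s) • W₂ (p.1 - s, p.2) :=
    mk _ (integrable_kernel_smul hk h₂ b₂)
  have g6 : Integrable fun s ↦ ((p.2 ^ 2)⁻¹ * k s) • Λ (W₀ (p.1 - s, p.2)) :=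
    mk _ (integrable_kernel_smul hk cΛ bΛ)
  have L : Λ (timeConv k W₀ p) = timeConv k (fun q ↦ Λ (W₀ q)) p := (timeConv_clm Λ k W₀ p i₀).symm
  -- both sides as one integral in the normal form `(c * k s) • X`
  simp only [rwOp]
  rw [L]
  simp only [timeConv_eq, ← integral_smul, smul_add, smul_smul]
  simp only [mul_comm (k _) _]
  rw [integral_add ?_ g6, integral_add ?_ g5, integral_add ?_ g4, integral_add ?_ g3,
    integral_add g1 g2]
  · exact g1.add g2
  · exact (g1.add g2).add g3
  · exact ((g1.add g2).add g3).add g4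
  · exact (((g1.add g2).add g3).add g4).add g5

end EternalPapapetrou.ModeRigidity

end Summit.FinalStateConjecture.FinalStateConjecture.Theorems
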